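import Summits.BirchSwinnertonDyer.Rank1Residual.X1.KellerYinTheoremA
import Summits.BirchSwinnertonDyer.Rank1Residual.X1.GoodLatticeExists
import HarnessLib

/-!
# THEOREM A of the cell `bsd-eis`, CLASS-WIDE: `BSD(E,p)` for EVERY `E/ℚ` with `ord_{s=1} L(E,s) = 1`
# at every good ANOMALOUS Eisenstein prime `p > 2` of parity type A — from Keller–Yin's IMC2 at `𝟙`
# for the good lattice (the ONE `_OPEN` input) and PUBLISHED named facts (seat `bsd-eis-ky` — file 3 of 3)

HONEST FRAMING (cell `bsd-eis`, home `run/shared/lean/pub/bsd-eis/`; FULL-BSD rank-≤1 programme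
D-0033, row A1 = X1a: 7 892 open census cells). THEOREMS ONLY; nothing booked, no label moved by this
file — the planner / coordinator rule on row A1. Files 1–2 (`X1/KellerYinGoodLattice.lean`,
`X1/KellerYinTheoremA.lean`) prove `BSD(E,p)` for every member of a rank-one type-A X1 isogeny class
GIVEN Keller–Yin's normalised member of the class (no rational `p`-line unramified at `p`). This file
feeds that member from the KERNEL THEOREM `X1.GoodLatticeExists.ribet_exists_isIsogenous_noUnramifiedLine_holds`
(the good lattice exists in every X1 isogeny class — proved in the tree from Shafarevich finiteness of the
isogeny class and the reduction line at the ordinary `p`; it discharges the cited fact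
`Literature.NumberTheory.EllipticCurves.ribet_exists_isIsogenous_noUnramifiedLine`, Ribet 1976 Prop. 2.1)
and states THEOREM A on the census curve:

  `ClassX1 W p → ¬ GVPar W p → W.analyticRank = 1 → BSDp W p`

granted — every binder a NAMED tree `Prop`, status in brackets —
`h308 : KellerYin2024.thm308_imc2_bdpValue_goodLattice_OPEN` [PREPRINT, `_OPEN`, the ONLY one;
Keller–Yin arXiv:2402.12781v2 Thm. 3.0.8 (IMC2) at `𝟙` ∘ [CGLS] Thm. 5.1.3; cell memo MEMO-1 §2–§3,
referee PASS], `h511 : CastellaGrossiLeeSkinner2022.thm511_anticyclotomicControl_of_torsionFree`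
[PUB, CGLS Thm. 5.1.1 as proved],
`hCassels : bsdRHS_eq_of_isIsogenous` [PUB, Cassels 1965 / Milne ADT I.7.3],
`hGV : GreenbergVatsal2000.thm13_charIdeal_eq_of_gvPar` [PUB], `hGr : greenberg_charValue_rankZero`
[PUB, LNM 1716 Thm. 4.1], `hmodP : nonempty_modularParametrizationData`, `hmod : exists_isNewformOf`
[PUB, modularity], `hHL : HoffsteinLuo1997_exists_twist_L_one_ne_zero` [PUB], `hGZQ :
GrossZagier1986_thm_I_7_3`, `hGZ : gross_zagier` [PUB], `hKo : kolyvagin` [PUB],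
`hGZK : rank_eq_analyticRank_of_analyticRank_le_one` [PUB]. Compare x1a's
`bsdp_of_classX1_typeA_of_analyticRank_eq_one_of_KY_OPEN` (same conclusion, binder = Keller–Yin's
whole rank-one display `thm421_rankOne_display_OPEN`, i.e. KY Thm. 3.0.8 + App. B + [CGLS] §5 for
every curve): here the preprint content is confined to ONE statement one level below the display,
on ONE member of the class, and everything else is a published fact or a kernel theorem. Riders: none
on `p` beyond `ClassX1` (`p > 2`); no Schneider / height input; no cyclotomic main conjecture at
type A (that conjecture, `MazurMainConjectureOnX1TypeA`, stays OPEN and is not used).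

References: [KellerYin2024] Thm. 4.2.1 (= Theorem C), Thm. 3.0.8, Prop. 1.3.1; [Ribet1976] Prop. 2.1;
[CastellaGrossiLeeSkinner2022] Thm. 5.3.1 and proof, Thms. 5.1.1–5.1.4; [GreenbergVatsal2000]
Thm. (1.3); [MilneADT2006] I.7.3; HOME/bsd-eis-ky-MEMO-1.md §2; HOME/bsd-eis-ky-MEMO-3.md.
-/

set_option autoImplicit false

noncomputable section

open scoped Classical

open WeierstrassCurve Literature.NumberTheory.EllipticCurves
  Literature.NumberTheory.EllipticCurves.ModularForms
  Literature.NumberTheory.EllipticCurves.Rank1Residual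
  Literature.NumberTheory.EllipticCurves.CastellaGrossiLeeSkinner2022
  Literature.NumberTheory.EllipticCurves.KellerYin2024
  Summit.BirchSwinnertonDyer.Rank1Residual.X1.KellerYinTheoremA

namespace Summit.BirchSwinnertonDyer.Rank1Residual.X1.KellerYinTheoremA

variable {p : ℕ} [Fact p.Prime]

/-- **THEOREM A (cell `bsd-eis`, memo MEMO-1 §2) on the census curve: X1 ∩ {type A, `r_an = 1`}
⟹ `BSD(E,p)`.** For `W/ℚ` globally minimal elliptic, `ClassX1 W p` (`p > 2` good, `E[p]`
reducible, `a_p ≡ 1 (mod p)`), `¬ GVPar W p` (parity type A) and `ord_{s=1} L(E,s) = 1`: Miller's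
`BSD(E,p)` — from the ONE open hypothesis `h308` (Keller–Yin Thm. 3.0.8 (IMC2) at `𝟙` ∘ BDP for the
good lattice, PREPRINT) and the PUBLISHED named facts `h511` (CGLS Thm. 5.1.1 as proved), `hCassels`
(isogeny invariance of the BSD quotient), `hGV` (Greenberg–Vatsal on the type-B partner), `hGr`,
`hmodP`, `hmod`, `hHL`, `hGZQ`, `hGZ`, `hKo`, `hGZK`. Proof: the kernel theorem
`GoodLatticeExists.ribet_exists_isIsogenous_noUnramifiedLine_holds` (Ribet's lemma / Keller–Yin
Prop. 1.3.1, PROVED in the tree) supplies `W' ∼ W` with no unramified rational `p`-line; file 2's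
`bsdp_of_isIsogenous_goodLattice_of_not_gvPar_of_analyticRank_eq_one` does the rest.
[claim: KellerYin2024, status: under-review]
[cite: KellerYin2024, Thm. 4.2.1 (Theorem C) and its proof (arXiv:2402.12781v2 §4.2), Thm. 3.0.8, Prop. 1.3.1]
[cite: Ribet1976, Prop. 2.1] [cite: CastellaGrossiLeeSkinner2022, Thm. 5.3.1 and its proof, Thm. 5.1.1]
[cite: GreenbergVatsal2000, Thm. (1.3)] [cite: MilneADT2006, Thm. I.7.3] [cite: Miller2011LMS, Def. 1.1] -/
theorem bsdp_of_classX1_of_not_gvPar_of_analyticRank_eq_one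
    (h308 : thm308_imc2_bdpValue_goodLattice_OPEN) (h511 : thm511_anticyclotomicControl_of_torsionFree)
    (hCassels : bsdRHS_eq_of_isIsogenous)
    (hGV : GreenbergVatsal2000.thm13_charIdeal_eq_of_gvPar) (hGr : greenberg_charValue_rankZero)
    (hmodP : nonempty_modularParametrizationData) (hmod : exists_isNewformOf)
    (hHL : HoffsteinLuo1997_exists_twist_L_one_ne_zero) (hGZQ : GrossZagier1986_thm_I_7_3)
    (hGZ : ∀ (N : ℕ) [NeZero N] (W : WeierstrassCurve ℚ) (K : Type) [Field K] [NumberField K],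
      gross_zagier N W K)
    (hKo : ∀ (N : ℕ) [NeZero N] (W : WeierstrassCurve ℚ) (K : Type) [Field K] [NumberField K],
      kolyvagin N W K)
    (hGZK : rank_eq_analyticRank_of_analyticRank_le_one)
    (W : WeierstrassCurve ℚ) [W.IsElliptic] [W.IsGloballyMinimal]
    (hX1 : ClassX1 W p) (hA : ¬ GVPar W p) (hr : W.analyticRank = 1) : BSDp W p := by
  obtain ⟨W', _, _, hiso, hGL⟩ :=
    GoodLatticeExists.ribet_exists_isIsogenous_noUnramifiedLine_holds W p hX1.1 hX1.2.2.1 hX1.2.1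
  exact bsdp_of_isIsogenous_goodLattice_of_not_gvPar_of_analyticRank_eq_one h308 h511 hCassels hGV hGr
    hmodP hmod hHL hGZQ hGZ hKo hGZK W hX1 hA hr W' hiso hGL

/-- **Row A1 in the partition's binder shape** (`Rank1ResidualX1Defs.bsdpOnClassX1_…` style): for ALL
globally minimal `W` and primes `p`, `ClassX1 W p → ¬ GVPar W p → W.analyticRank = 1 → BSDp W p`,
granted the one open hypothesis and the published facts — the `∀`-packaged form for the cell's
closure tables. [claim: KellerYin2024, status: under-review]
[cite: KellerYin2024, Thm. 4.2.1 (Theorem C), Thm. 3.0.8] [cite: CastellaGrossiLeeSkinner2022, Thm. 5.3.1] -/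
theorem forall_bsdp_classX1_typeA_rankOne
    (h308 : thm308_imc2_bdpValue_goodLattice_OPEN) (h511 : thm511_anticyclotomicControl_of_torsionFree)
    (hCassels : bsdRHS_eq_of_isIsogenous)
    (hGV : GreenbergVatsal2000.thm13_charIdeal_eq_of_gvPar) (hGr : greenberg_charValue_rankZero)
    (hmodP : nonempty_modularParametrizationData) (hmod : exists_isNewformOf)
    (hHL : HoffsteinLuo1997_exists_twist_L_one_ne_zero) (hGZQ : GrossZagier1986_thm_I_7_3)
    (hGZ : ∀ (N : ℕ) [NeZero N] (W : WeierstrassCurve ℚ) (K : Type) [Field K] [NumberField K],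
      gross_zagier N W K)
    (hKo : ∀ (N : ℕ) [NeZero N] (W : WeierstrassCurve ℚ) (K : Type) [Field K] [NumberField K],
      kolyvagin N W K)
    (hGZK : rank_eq_analyticRank_of_analyticRank_le_one) :
    ∀ (W : WeierstrassCurve ℚ) [W.IsElliptic] [W.IsGloballyMinimal] (p : ℕ) [Fact p.Prime],
      ClassX1 W p → ¬ GVPar W p → W.analyticRank = 1 → BSDp W p :=
  fun W _ _ _ _ hX1 hA hr ↦
    bsdp_of_classX1_of_not_gvPar_of_analyticRank_eq_one h308 h511 hCassels hGV hGr hmodP hmod hHL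
      hGZQ hGZ hKo hGZK W hX1 hA hr

end Summit.BirchSwinnertonDyer.Rank1Residual.X1.KellerYinTheoremA

end
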